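import Summits.ValiantsHypothesis.ValiantsHypothesis.Theses.BarrierLever
import Summits.ValiantsHypothesis.ValiantsHypothesis.Theorems.BarrierLeverIntegerBoxVanishingTransferSeedGrid
import Summits.ValiantsHypothesis.ValiantsHypothesis.Theorems.BarrierLeverNaturalProofsSeparateVNPSignSliceIntVec

/-!
# Route BarrierLever — item 19906 `NonzeroOnBoxAboveDegree` (coefficient axis of the V4 door)

Item `stmt-ValiantsHypothesis-19906` (support, rank 9; planner p2-g7, cell valiant-natproofs, rung V4;
bears_on crux stmt-ValiantsHypothesis-14610 = FSV Question 6 — it neither restates nor weakens the crux;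
unconditional). NONZERO DISTINGUISHERS ARE NONZERO ON THE BOX ABOVE THE DEGREE: if `N^a < 2h + 1`
(`N = C(2n,n)`) then every nonzero level-`a` distinguisher `D` (degree `≤ N^a`) is nonzero at some
degree-`≤ n` polynomial `g` whose coefficients are integers of modulus `≤ h`.

**Proof** (planner p2-g7's, re-derived here because the attached scratch `CoeffAxis2-p2g7.lean` is not
readable from a prover jail; every ingredient is already in the tree): Alon's Combinatorial
Nullstellensatz on the integer grid `{-h, …, h}^{degLEMonomials n}` in the form of the tree's
`IntSlice.eq_zero_of_eval_int_grid` (item 20033's part 1: a polynomial of total degree `≤ 2h` vanishing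
on the grid is zero; here `deg D ≤ N^a ≤ 2h`), plus the bookkeeping that every integer grid vector `c`
is the coefficient vector of `g = ∑_m c_m x^m` of total degree `≤ n` — the tree's
`NaturalProofsSeparateVNP.SignSlice.ofIntVec` with `coeffVector_ofIntVec`, `coeff_ofIntVec(_of_not)`,
`totalDegree_ofIntVec_le`.

READING (planner): together with item 19905 (`BoxTransferFailsBelowDegree`) this identifies the two door
notions — «hitting» and «all-D transfer» — in the window of box heights ABOVE the degree `N^a`; below
it transfer fails outright.

WHAT THIS IS NOT: nothing on FSV Question 6 / crux stmt-ValiantsHypothesis-14610 or on VP vs VNP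
(VP ≠ VNP is NOT proved; this is unconditional largeness on the coefficient axis of the door).
-/

-- layout Summits/ValiantsHypothesis/ValiantsHypothesis forces the duplicated namespace component
set_option linter.dupNamespace false

namespace Summit.ValiantsHypothesis.ValiantsHypothesis.Theorems.BarrierLever.CoeffAxis

open MvPolynomial Literature.Barriers.ValiantsHypothesis
open Summit.ValiantsHypothesis.ValiantsHypothesis.Theorems.BarrierLever.NaturalProofsSeparateVNP

/-- **Largeness on the integer box above the degree** (the working form): a nonzero polynomial in the
coefficient variables of total degree `≤ 2h` is nonzero at the coefficient vector of some degree-`≤ n`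
polynomial with integer coefficients of modulus `≤ h`. -/
theorem exists_intBox_eval_ne_zero_of_totalDegree_le {n h : ℕ}
    {D : MvPolynomial (degLEMonomials n) ℂ} (hdeg : D.totalDegree ≤ 2 * h) (hD0 : D ≠ 0) :
    ∃ g : MvPolynomial (Fin n) ℂ, g.totalDegree ≤ n ∧
      (∀ m : Fin n →₀ ℕ, ∃ z : ℤ, MvPolynomial.coeff m g = (z : ℂ) ∧ |z| ≤ (h : ℤ)) ∧
      MvPolynomial.eval (coeffVector (degLEMonomials n) g) D ≠ 0 := by
  classical
  by_contra hcon
  push Not at hcon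
  apply hD0
  refine IntSlice.eq_zero_of_eval_int_grid D h hdeg (fun y hy => ?_)
  have h1 := hcon (SignSlice.ofIntVec y) (SignSlice.totalDegree_ofIntVec_le y) (fun μ => ?_)
  · rwa [SignSlice.coeffVector_ofIntVec] at h1
  · by_cases hμ : μ ∈ degLEMonomials n
    · exact ⟨y ⟨μ, hμ⟩, SignSlice.coeff_ofIntVec y ⟨μ, hμ⟩, hy _⟩
    · exact ⟨0, by rw [SignSlice.coeff_ofIntVec_of_not y hμ, Int.cast_zero], by simp⟩

/-- **Item 19906 `NonzeroOnBoxAboveDegree`** (the route decl, by name). -/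
theorem nonzeroOnBoxAboveDegree : Theses.BarrierLever.NonzeroOnBoxAboveDegree := by
  intro n a h hlt D hD hD0
  exact exists_intBox_eval_ne_zero_of_totalDegree_le (hD.2.trans (by omega)) hD0

end Summit.ValiantsHypothesis.ValiantsHypothesis.Theorems.BarrierLever.CoeffAxis
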